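import Summits.KontsevichZagierPeriods.KontsevichZagierPeriods.Theorems.SoloInformedAlgToricFace
import Summits.KontsevichZagierPeriods.KontsevichZagierPeriods.Theorems.SoloInformedToricTermwise
import HarnessLib

/-!
# Termwise integrability of `P/Q`, real algebraic coefficients

Solo programme `solo-KontsevichZagierPeriods-informed`, session s107: the re-base of the
DEN-calculus of the cube crux on a coefficient field `K` of real algebraic numbers, step 4 —
the `K`-version of `SoloInformedToricTermwise` / the scaling and truncation lemmas of
`SoloInformedToricNumerators`.

Let `Q ∈ K[x₁, …, xₙ]` be cube-nondegenerate (`SoloInformedCubeNondegenerateK`) and `P ∈ K[x]`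
arbitrary.  If `P/Q` is integrable on the open cube `(0,1)ⁿ` then so is every monomial piece
`xᵃ/Q`, `a ∈ supp P` (`soloInformed_integrableOn_monomial_divK`): on each toric chart `μ_A` the
pulled-back form is `|det A| · (∑_a c_a v^{Aᵀ(a+1)}) / (v^{m+1} · Q_A(v))` with the unit `Q_A`
(`soloInformed_chartQuotK_mul_pullback`), the exponent vectors `Aᵀ(a+1)` are pairwise distinct, so
the Laurent integrability test `soloInformed_le_of_integrableOn_laurent` forces `m + 1 ≤ Aᵀ(a+1)`
for every `a ∈ supp P` (`soloInformed_chart_exponent_leK`); the chart images cover the open cube up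
to a null set.  Hence every truncation `P_t/Q` (`soloInformedTruncK`) is integrable
(`soloInformed_integrableOn_truncK_div_of_terms`).  Also: cube-nondegeneracy is invariant under
scaling by a non-zero constant (`soloInformed_cubeNondegenerateK_smul`).

References: A. G. Kouchnirenko, Invent. Math. 32 (1976) §1; A. N. Varchenko, Funct. Anal. Appl.
10 (1976); KKMS, LNM 339 (1973) ch. I.
-/

noncomputable section

open scoped BigOperators
open MeasureTheory Set
open Literature.NumberTheory.Transcendental Literature.NumberTheory.Transcendental.KZ
open Literature.ModelTheory.ExponentialFields (IsSemialgebraic)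
open Literature.AlgebraicGeometry.Resolution

namespace Summit.KontsevichZagierPeriods.KontsevichZagierPeriods.Theorems

variable {n : ℕ}

/-! ### Truncations over a general coefficient semiring -/

section CoeffRing

variable {k : Type*} [CommSemiring k]

/-- The truncation `P_t := ∑_{a ∈ t} coeff_a(P) · X^a` of `P ∈ k[x]` to a set `t` of exponents.
[this work] -/
def soloInformedTruncK (P : MvPolynomial (Fin n) k) (t : Finset (Fin n →₀ ℕ)) :
    MvPolynomial (Fin n) k :=
  ∑ a ∈ t, MvPolynomial.monomial a (MvPolynomial.coeff a P)

/-- Evaluation of a truncation. [this work] -/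
theorem soloInformed_aeval_truncK {R : Type*} [CommSemiring R] [Algebra k R]
    (P : MvPolynomial (Fin n) k) (t : Finset (Fin n →₀ ℕ)) (x : Fin n → R) :
    MvPolynomial.aeval x (soloInformedTruncK P t) =
      ∑ a ∈ t, algebraMap k R (MvPolynomial.coeff a P) * ∏ i, x i ^ a i := by
  unfold soloInformedTruncK
  rw [map_sum]
  exact Finset.sum_congr rfl fun a _ => by
    rw [MvPolynomial.aeval_monomial, Finsupp.prod_fintype _ _ fun i => pow_zero _]

/-- The full truncation is the polynomial itself. [this work] -/
theorem soloInformed_truncK_support (P : MvPolynomial (Fin n) k) :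
    soloInformedTruncK P P.support = P := by
  unfold soloInformedTruncK
  exact (MvPolynomial.as_sum P).symm

end CoeffRing

variable {K : Type*} [Field K] [Algebra K ℝ]

/-! ### Scaling -/

omit [Algebra K ℝ] in
open Classical in
/-- `in_w(c • Q) = c • in_w(Q)` for `c ≠ 0` (same support, scaled coefficients). [this work] -/
theorem soloInformed_initFormK_smul (w : Fin n → ℕ) (Q : MvPolynomial (Fin n) K) {c : K}
    (hc : c ≠ 0) : soloInformedInitFormK w (c • Q) = c • soloInformedInitFormK w Q := by
  unfold soloInformedInitFormK
  have hs : (c • Q).support = Q.support := MvPolynomial.support_smul_eq hc Q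
  have hI : ∀ a, SoloInformedIsInitK w (c • Q) a ↔ SoloInformedIsInitK w Q a := fun a => by
    unfold SoloInformedIsInitK
    rw [hs]
  have hf : (c • Q).support.filter (SoloInformedIsInitK w (c • Q)) =
      Q.support.filter (SoloInformedIsInitK w Q) := by
    rw [hs]
    exact Finset.filter_congr fun a _ => hI a
  rw [hf, Finset.smul_sum]
  exact Finset.sum_congr rfl fun a _ => by
    rw [MvPolynomial.coeff_smul, MvPolynomial.smul_monomial]

/-- **Cube-nondegeneracy is invariant under scaling** `Q ↦ c • Q`, `c ∈ K`, `c ≠ 0`. [this work] -/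
theorem soloInformed_cubeNondegenerateK_smul {Q : MvPolynomial (Fin n) K}
    (hND : SoloInformedCubeNondegenerateK Q) {c : K} (hc : c ≠ 0) :
    SoloInformedCubeNondegenerateK (c • Q) := by
  intro w y hy
  rw [soloInformed_initFormK_smul w Q hc, map_smul, Algebra.smul_def]
  exact mul_ne_zero ((map_ne_zero (algebraMap K ℝ)).2 hc) (hND w y hy)

/-! ### The pulled-back form and the exponent inequality on a chart -/

/-- **The pulled-back form on a chart.**  For `v ∈ (0,1)ⁿ` with `Q_A(v) ≠ 0` and `m ≤ Aᵀ a`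
(`a ∈ supp Q`):
`(Q_A(v)/|det A|) · |det Dμ_A(v)| · P(μ_A v)/Q(μ_A v) = (∑_{a ∈ supp P} c_a v^{Aᵀ(a+1)}) / v^{m+1}`.
[this work] -/
theorem soloInformed_chartQuotK_mul_pullback (A : Matrix (Fin n) (Fin n) ℕ)
    (hA : (A.map (fun t : ℕ => (t : ℝ))).det ≠ 0) (P Q : MvPolynomial (Fin n) K) (m : Fin n → ℕ)
    (hmin : ∀ a ∈ Q.support, ∀ j, m j ≤ ∑ i, A i j * a i) {v : Fin n → ℝ}
    (hv : v ∈ soloInformedOpenCube n)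
    (hQA : (MvPolynomial.aeval v (soloInformedChartQuotK A Q m) : ℝ) ≠ 0) :
    ((MvPolynomial.aeval v (soloInformedChartQuotK A Q m) : ℝ) /
        |(A.map (fun t : ℕ => (t : ℝ))).det|) *
      (|(soloInformedMonoD A v).det| •
        ((MvPolynomial.aeval (fun i => ∏ j, v j ^ A i j) P : ℝ) /
          MvPolynomial.aeval (fun i => ∏ j, v j ^ A i j) Q)) =
      (∑ a ∈ P.support, algebraMap K ℝ (MvPolynomial.coeff a P) *
        ∏ j, v j ^ ((∑ i, A i j * a i) + ∑ i, A i j)) / ∏ j, v j ^ (m j + 1) := by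
  have hv0 : ∀ j, 0 < v j := fun j => (hv j).1
  have hsum : (∑ a ∈ P.support, algebraMap K ℝ (MvPolynomial.coeff a P) *
        ∏ j, v j ^ ((∑ i, A i j * a i) + ∑ i, A i j)) =
      (MvPolynomial.aeval (fun i => ∏ j, v j ^ A i j) P : ℝ) * ∏ j, v j ^ (∑ i, A i j) := by
    rw [soloInformed_aevalK_eq_sum_support, Finset.sum_mul]
    refine Finset.sum_congr rfl fun a _ => ?_
    rw [prod_pow_monomialMap A (fun i => a i) (fun i => rfl), mul_assoc, ← Finset.prod_mul_distrib]
    exact congrArg _ (Finset.prod_congr rfl fun j _ => pow_add _ _ _)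
  have hW : (∏ j, v j ^ (m j + 1)) = (∏ j, v j ^ m j) * ∏ j, v j := by
    rw [← Finset.prod_mul_distrib]
    exact Finset.prod_congr rfl fun j _ => pow_succ _ _
  rw [hsum, hW, smul_eq_mul, soloInformed_abs_det_monoD A hv0,
    soloInformed_aevalK_monomialMap_eq A Q m hmin v]
  have h1 : (∏ j, v j) ≠ 0 := Finset.prod_ne_zero_iff.2 fun j _ => (hv0 j).ne'
  have h2 : (∏ j, v j ^ m j) ≠ 0 :=
    Finset.prod_ne_zero_iff.2 fun j _ => pow_ne_zero _ (hv0 j).ne'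
  have h4 : |(A.map (fun t : ℕ => (t : ℝ))).det| ≠ 0 := abs_ne_zero.2 hA
  field_simp

/-- **Exponent inequality on a chart.**  If `P/Q` is integrable on the chart image `μ_A((0,1)ⁿ)`
and the chart quotient `Q_A` has no zero on the closed cube, then `m + 1 ≤ Aᵀ(a + 1)`
componentwise for EVERY `a ∈ supp P` (Laurent integrability test: no cancellation between the
distinct monomials `v^{Aᵀ(a+1)}`). [this work] -/
theorem soloInformed_chart_exponent_leK (A : Matrix (Fin n) (Fin n) ℕ)
    (hA : (A.map (fun t : ℕ => (t : ℝ))).det ≠ 0) (P Q : MvPolynomial (Fin n) K) (m : Fin n → ℕ)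
    (hmin : ∀ a ∈ Q.support, ∀ j, m j ≤ ∑ i, A i j * a i)
    (hQc : ∀ x : Fin n → ℝ, (∀ j, 0 ≤ x j ∧ x j ≤ 1) →
      (MvPolynomial.aeval x (soloInformedChartQuotK A Q m) : ℝ) ≠ 0)
    (hint : IntegrableOn (fun x => (MvPolynomial.aeval x P : ℝ) / MvPolynomial.aeval x Q)
      ((fun (v : Fin n → ℝ) (i : Fin n) => ∏ j, v j ^ A i j) '' soloInformedOpenCube n)) :
    ∀ a ∈ P.support, ∀ j, m j + 1 ≤ (∑ i, A i j * a i) + ∑ i, A i j := by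
  classical
  have hO := soloInformedOpenCube_eq_pi n
  have hQc_ne : ∀ v ∈ soloInformedOpenCube n,
      (MvPolynomial.aeval v (soloInformedChartQuotK A Q m) : ℝ) ≠ 0 :=
    fun v hv => hQc v fun j => ⟨(hv j).1.le, (hv j).2.le⟩
  have hmeasO : MeasurableSet (soloInformedOpenCube n) := by
    rw [hO]; exact MeasurableSet.univ_pi fun _ => measurableSet_Ioo
  have hderiv : ∀ x ∈ soloInformedOpenCube n, HasFDerivWithinAt
      (fun (v : Fin n → ℝ) (i : Fin n) => ∏ j, v j ^ A i j) (soloInformedMonoD A x)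
      (soloInformedOpenCube n) x :=
    fun x _ => soloInformed_hasFDerivWithinAt_monomialMap A _ x
  have hinj : InjOn (fun (v : Fin n → ℝ) (i : Fin n) => ∏ j, v j ^ A i j)
      (soloInformedOpenCube n) := by
    rw [hO]; exact injOn_monomialMap_pi_Ioo hA
  -- change of variables
  have hint1 : IntegrableOn (fun v => |(soloInformedMonoD A v).det| •
      ((MvPolynomial.aeval (fun i => ∏ j, v j ^ A i j) P : ℝ) /
        MvPolynomial.aeval (fun i => ∏ j, v j ^ A i j) Q)) (soloInformedOpenCube n) := by
    have h := hint
    rw [integrableOn_image_iff_integrableOn_abs_det_fderiv_smul volume hmeasO hderiv hinj] at h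
    exact h
  -- the bounded continuous factor `Q_A(v)/|det A|`
  have hcont : Continuous fun v : Fin n → ℝ =>
      (MvPolynomial.aeval v (soloInformedChartQuotK A Q m) : ℝ) :=
    soloInformed_continuous_aevalK _
  obtain ⟨C, hC⟩ : ∃ C : ℝ, ∀ x ∈ soloInformedCube n,
      ‖(MvPolynomial.aeval x (soloInformedChartQuotK A Q m) : ℝ)‖ ≤ C := by
    have hK : IsCompact (soloInformedCube n) := by
      rw [soloInformedCube_eq_Icc]; exact isCompact_Icc
    exact hK.exists_bound_of_continuousOn hcont.continuousOn
  have hlaur : IntegrableOn (fun v : Fin n → ℝ =>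
      (∑ a ∈ P.support, algebraMap K ℝ (MvPolynomial.coeff a P) *
        ∏ j, v j ^ ((∑ i, A i j * a i) + ∑ i, A i j)) / ∏ j, v j ^ (m j + 1))
      (Set.pi univ fun _ : Fin n => Ioo (0 : ℝ) 1) := by
    rw [← hO]
    have hb : IntegrableOn (fun v => ((MvPolynomial.aeval v (soloInformedChartQuotK A Q m) : ℝ) /
        |(A.map (fun t : ℕ => (t : ℝ))).det|) * (|(soloInformedMonoD A v).det| •
        ((MvPolynomial.aeval (fun i => ∏ j, v j ^ A i j) P : ℝ) /
          MvPolynomial.aeval (fun i => ∏ j, v j ^ A i j) Q))) (soloInformedOpenCube n) := by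
      refine Integrable.bdd_mul hint1 ((hcont.div_const _).aestronglyMeasurable)
        (c := C / |(A.map (fun t : ℕ => (t : ℝ))).det|)
        (ae_restrict_of_forall_mem hmeasO fun v hv => ?_)
      rw [Real.norm_eq_abs, abs_div, abs_abs]
      exact div_le_div_of_nonneg_right
        (by simpa [Real.norm_eq_abs] using hC v (soloInformedOpenCube_subset_cube n hv))
        (abs_nonneg _)
    exact hb.congr_fun (fun v hv => soloInformed_chartQuotK_mul_pullback A hA P Q m hmin hv
      (hQc_ne v hv)) hmeasO
  -- the Laurent test
  intro a ha j
  refine soloInformed_le_of_integrableOn_laurent P.support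
    (fun a => algebraMap K ℝ (MvPolynomial.coeff a P))
    (fun (a : Fin n →₀ ℕ) (j : Fin n) => (∑ i, A i j * a i) + ∑ i, A i j) (fun j => m j + 1)
    (fun b hb => (map_ne_zero (algebraMap K ℝ)).2 (MvPolynomial.mem_support_iff.1 hb))
    (fun b _ b' _ hbb' => Finsupp.ext fun i => ?_) hlaur a ha j
  have h1 : ∀ j, ∑ i, A i j * b i = ∑ i, A i j * b' i := fun j =>
    Nat.add_right_cancel (congr_fun hbb' j)
  exact congr_fun (soloInformed_eq_of_transpose_apply_eq A hA h1) i

/-! ### Termwise integrability -/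

/-- **Termwise integrability on a chart image**: under the hypotheses of
`soloInformed_chart_exponent_leK`, every monomial piece `xᵃ/Q` (`a ∈ supp P`) is integrable on
`μ_A((0,1)ⁿ)` — it pulls back to the continuous germ `|det A| · v^e / Q_A(v)`, `e ≥ 0`. [this work] -/
theorem soloInformed_integrableOn_monomial_div_chartK (A : Matrix (Fin n) (Fin n) ℕ)
    (hA : (A.map (fun t : ℕ => (t : ℝ))).det ≠ 0) (P Q : MvPolynomial (Fin n) K) (m : Fin n → ℕ)
    (hmin : ∀ a ∈ Q.support, ∀ j, m j ≤ ∑ i, A i j * a i)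
    (hQc : ∀ x : Fin n → ℝ, (∀ j, 0 ≤ x j ∧ x j ≤ 1) →
      (MvPolynomial.aeval x (soloInformedChartQuotK A Q m) : ℝ) ≠ 0)
    (hint : IntegrableOn (fun x => (MvPolynomial.aeval x P : ℝ) / MvPolynomial.aeval x Q)
      ((fun (v : Fin n → ℝ) (i : Fin n) => ∏ j, v j ^ A i j) '' soloInformedOpenCube n))
    {a : Fin n →₀ ℕ} (ha : a ∈ P.support) :
    IntegrableOn (fun x => (∏ j, x j ^ a j) / (MvPolynomial.aeval x Q : ℝ))
      ((fun (v : Fin n → ℝ) (i : Fin n) => ∏ j, v j ^ A i j) '' soloInformedOpenCube n) := by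
  classical
  have hO := soloInformedOpenCube_eq_pi n
  have hle := soloInformed_chart_exponent_leK A hA P Q m hmin hQc hint a ha
  obtain ⟨e, he⟩ : ∃ e : Fin n → ℕ, ∀ j, (∑ i, A i j * a i) + ∑ i, A i j = (m j + 1) + e j :=
    ⟨fun j => ((∑ i, A i j * a i) + ∑ i, A i j) - (m j + 1),
      fun j => (Nat.add_sub_cancel' (hle j)).symm⟩
  have hmeasO : MeasurableSet (soloInformedOpenCube n) := by
    rw [hO]; exact MeasurableSet.univ_pi fun _ => measurableSet_Ioo
  have hderiv : ∀ x ∈ soloInformedOpenCube n, HasFDerivWithinAt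
      (fun (v : Fin n → ℝ) (i : Fin n) => ∏ j, v j ^ A i j) (soloInformedMonoD A x)
      (soloInformedOpenCube n) x :=
    fun x _ => soloInformed_hasFDerivWithinAt_monomialMap A _ x
  have hinj : InjOn (fun (v : Fin n → ℝ) (i : Fin n) => ∏ j, v j ^ A i j)
      (soloInformedOpenCube n) := by
    rw [hO]; exact injOn_monomialMap_pi_Ioo hA
  rw [integrableOn_image_iff_integrableOn_abs_det_fderiv_smul volume hmeasO hderiv hinj]
  -- the germ `|det A| · v^e / Q_A(v)` is continuous on the closed cube
  have hcont : Continuous fun v : Fin n → ℝ =>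
      (MvPolynomial.aeval v (soloInformedChartQuotK A Q m) : ℝ) :=
    soloInformed_continuous_aevalK _
  have hg : IntegrableOn (fun v : Fin n → ℝ => |(A.map (fun t : ℕ => (t : ℝ))).det| *
      ((∏ j, v j ^ e j) / (MvPolynomial.aeval v (soloInformedChartQuotK A Q m) : ℝ)))
      (soloInformedOpenCube n) := by
    have hK : IsCompact (soloInformedCube n) := by
      rw [soloInformedCube_eq_Icc]; exact isCompact_Icc
    refine (ContinuousOn.integrableOn_compact hK ?_).mono_set (soloInformedOpenCube_subset_cube n)
    refine continuousOn_const.mul (ContinuousOn.div (Continuous.continuousOn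
      (continuous_finsetProd _ fun j _ => (continuous_apply j).pow _)) hcont.continuousOn
      fun x hx => hQc x (soloInformed_mem_cube_iff.1 hx))
  refine hg.congr_fun (fun v hv => ?_) hmeasO
  have hv0 : ∀ j, 0 < v j := fun j => (hv j).1
  have hQA : (MvPolynomial.aeval v (soloInformedChartQuotK A Q m) : ℝ) ≠ 0 :=
    hQc v fun j => ⟨(hv j).1.le, (hv j).2.le⟩
  -- the monomial identity: from the pull-back formula for `P := X^a`
  have hk := soloInformed_chartQuotK_mul_pullback A hA (MvPolynomial.monomial a (1 : K)) Q m hmin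
    hv hQA
  have hsupp : (MvPolynomial.monomial a (1 : K)).support = {a} := by
    rw [MvPolynomial.support_monomial, if_neg one_ne_zero]
  rw [hsupp, Finset.sum_singleton, MvPolynomial.coeff_monomial, if_pos rfl,
    MvPolynomial.aeval_monomial, Finsupp.prod_fintype _ _ (fun i => pow_zero _)] at hk
  simp only [map_one, one_mul] at hk
  have hU : (∏ j, v j ^ ((∑ i, A i j * a i) + ∑ i, A i j)) =
      (∏ j, v j ^ (m j + 1)) * ∏ j, v j ^ e j := by
    rw [← Finset.prod_mul_distrib]
    exact Finset.prod_congr rfl fun j _ => by rw [he j, pow_add]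
  have h1 : (∏ j, v j ^ (m j + 1)) ≠ 0 :=
    Finset.prod_ne_zero_iff.2 fun j _ => pow_ne_zero _ (hv0 j).ne'
  have h4 : |(A.map (fun t : ℕ => (t : ℝ))).det| ≠ 0 := abs_ne_zero.2 hA
  rw [hU, mul_div_cancel_left₀ _ h1] at hk
  -- solve for the pulled-back form
  have h5 : (MvPolynomial.aeval v (soloInformedChartQuotK A Q m) : ℝ) /
      |(A.map (fun t : ℕ => (t : ℝ))).det| ≠ 0 := div_ne_zero hQA h4
  show |(A.map (fun t : ℕ => (t : ℝ))).det| *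
      ((∏ j, v j ^ e j) / (MvPolynomial.aeval v (soloInformedChartQuotK A Q m) : ℝ)) =
    |(soloInformedMonoD A v).det| •
      ((∏ i, (∏ j, v j ^ A i j) ^ a i) /
        (MvPolynomial.aeval (fun i => ∏ j, v j ^ A i j) Q : ℝ))
  rw [← mul_right_inj' h5, hk]
  field_simp

/-- **Termwise integrability on the open cube.**  If `Q ∈ K[x]` is cube-nondegenerate and `P/Q`
is integrable on `(0,1)ⁿ`, then `xᵃ/Q` is integrable on `(0,1)ⁿ` for every `a ∈ supp P`.
[this work] -/
theorem soloInformed_integrableOn_monomial_divK (P Q : MvPolynomial (Fin n) K)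
    (hND : SoloInformedCubeNondegenerateK Q)
    (hint : IntegrableOn (fun x => (MvPolynomial.aeval x P : ℝ) / MvPolynomial.aeval x Q)
      (soloInformedOpenCube n)) {a : Fin n →₀ ℕ} (ha : a ∈ P.support) :
    IntegrableOn (fun x => (∏ j, x j ^ a j) / (MvPolynomial.aeval x Q : ℝ))
      (soloInformedOpenCube n) := by
  classical
  have hQ0 : Q ≠ 0 := soloInformed_ne_zero_of_cubeNondegenerateK hND
  have hO := soloInformedOpenCube_eq_pi n
  obtain ⟨M, A, hdet, -, hcov, hcmp⟩ :=
    MonomialCubeChart.exists_cube_charts_pairwise_comparable n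
      (Q.support.image fun a : Fin n →₀ ℕ => (a : Fin n → ℕ))
  rw [← hO] at hcov
  have hne : Q.support.Nonempty :=
    Finset.nonempty_iff_ne_empty.2 fun h => hQ0 (MvPolynomial.support_eq_empty.1 h)
  have hmaps : ∀ c, MapsTo (fun (v : Fin n → ℝ) (i : Fin n) => ∏ j, v j ^ A c i j)
      (soloInformedOpenCube n) (soloInformedOpenCube n) := fun c => by
    rw [hO]; exact monomialMap_mapsTo_pi_Ioo (hdet c)
  have hchart : ∀ c, IntegrableOn (fun x => (∏ j, x j ^ a j) / (MvPolynomial.aeval x Q : ℝ))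
      ((fun (v : Fin n → ℝ) (i : Fin n) => ∏ j, v j ^ A c i j) '' soloInformedOpenCube n) := by
    intro c
    obtain ⟨a₀, ha₀, hmin⟩ := soloInformed_exists_least_of_pairwise_comparable Q.support hne
      (fun (a : Fin n →₀ ℕ) (j : Fin n) => ∑ i, A c i j * a i) fun a ha b hb =>
        hcmp c _ (Finset.mem_image_of_mem _ ha) _ (Finset.mem_image_of_mem _ hb)
    exact soloInformed_integrableOn_monomial_div_chartK (A c) (hdet c) P Q
      (fun j => ∑ i, A c i j * a₀ i) hmin
      (fun x hx => soloInformed_chartQuotK_ne_zero_of_nondegenerate (A c) Q hND ha₀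
        (fun j => rfl) hmin hx)
      (hint.mono_set (hmaps c).image_subset) ha
  have hU : IntegrableOn (fun x => (∏ j, x j ^ a j) / (MvPolynomial.aeval x Q : ℝ))
      (⋃ c, (fun (v : Fin n → ℝ) (i : Fin n) => ∏ j, v j ^ A c i j) '' soloInformedOpenCube n) :=
    integrableOn_finite_iUnion.2 hchart
  have hN : IntegrableOn (fun x => (∏ j, x j ^ a j) / (MvPolynomial.aeval x Q : ℝ))
      (soloInformedOpenCube n \
        ⋃ c, (fun (v : Fin n → ℝ) (i : Fin n) => ∏ j, v j ^ A c i j) '' soloInformedOpenCube n) := by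
    rw [IntegrableOn, Measure.restrict_eq_zero.2 hcov]
    exact integrable_zero_measure
  refine (hU.union hN).mono_set fun x hx => ?_
  by_cases h : x ∈ ⋃ c, (fun (v : Fin n → ℝ) (i : Fin n) => ∏ j, v j ^ A c i j) ''
      soloInformedOpenCube n
  · exact Or.inl h
  · exact Or.inr ⟨hx, h⟩

/-- Integrability of every truncation `P_t/Q` from termwise integrability. [this work] -/
theorem soloInformed_integrableOn_truncK_div_of_terms (P Q : MvPolynomial (Fin n) K)
    (t : Finset (Fin n →₀ ℕ))
    (hterm : ∀ a ∈ t, IntegrableOn (fun x => (∏ j, x j ^ a j) / (MvPolynomial.aeval x Q : ℝ))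
      (soloInformedOpenCube n)) :
    IntegrableOn (fun x => (MvPolynomial.aeval x (soloInformedTruncK P t) : ℝ) /
      MvPolynomial.aeval x Q) (soloInformedOpenCube n) := by
  have h : (fun x : Fin n → ℝ =>
      (MvPolynomial.aeval x (soloInformedTruncK P t) : ℝ) / MvPolynomial.aeval x Q) =
      fun x => ∑ a ∈ t, algebraMap K ℝ (MvPolynomial.coeff a P) *
        ((∏ j, x j ^ a j) / (MvPolynomial.aeval x Q : ℝ)) := by
    funext x
    rw [soloInformed_aeval_truncK, Finset.sum_div]
    exact Finset.sum_congr rfl fun a _ => mul_div_assoc _ _ _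
  rw [h]
  exact integrable_finsetSum t fun a ha => (hterm a ha).const_mul _

/-- **Integrability splits termwise on the nondegenerate sector.**  For cube-nondegenerate
`Q ∈ K[x]`, `P/Q ∈ L¹((0,1)ⁿ)` iff `xᵃ/Q ∈ L¹((0,1)ⁿ)` for every `a ∈ supp P`. [this work] -/
theorem soloInformed_integrableOn_divK_iff_terms (P Q : MvPolynomial (Fin n) K)
    (hND : SoloInformedCubeNondegenerateK Q) :
    IntegrableOn (fun x => (MvPolynomial.aeval x P : ℝ) / MvPolynomial.aeval x Q)
        (soloInformedOpenCube n) ↔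
      ∀ a ∈ P.support, IntegrableOn (fun x => (∏ j, x j ^ a j) / (MvPolynomial.aeval x Q : ℝ))
        (soloInformedOpenCube n) := by
  refine ⟨fun h a ha => soloInformed_integrableOn_monomial_divK P Q hND h ha, fun h => ?_⟩
  have h1 := soloInformed_integrableOn_truncK_div_of_terms P Q P.support h
  refine h1.congr_fun (fun x _ => ?_) (by
    rw [soloInformedOpenCube_eq_pi]; exact MeasurableSet.univ_pi fun _ => measurableSet_Ioo)
  show (MvPolynomial.aeval x (soloInformedTruncK P P.support) : ℝ) / _ = _
  rw [soloInformed_truncK_support]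

end Summit.KontsevichZagierPeriods.KontsevichZagierPeriods.Theorems
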